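import Summits.QuantumAdvantage.QuantumAdvantage.Statement
import Summits.QuantumAdvantage.QuantumAdvantage.Theses.DyadicGap
import Literature.Computability.Complexity.CircuitLowerBoundsIW
import Literature.Computability.Complexity.ProbabilisticClassesProofs
import Literature.Computability.Complexity.CircuitClassesUniformProofs

/-!
# Probes for the derandomization cut of `DyadicGap.Target` (stmt-QuantumAdvantage-1840) — self-certifying form

Every `example` below is one CHEAP PROBE of the BC2-redirect certificate, in the instruction's combinator
`first | exact? | simpa [C] | (unfold C; simpa) | aesop` (aesop TERMINAL so that failure falls through) followed by `| sorry`: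
a probe that FAILS leaves exactly one `sorry`; a probe that SUCCEEDS leaves none. Expected: rc 0, sorries = number of probes
(all fail), except the calibration probe C0 (`QuantizedSignInBQP → Target → S`, which is the route's `closes` and must SUCCEED).
Imports are generous (the route file, IW97 `CircuitLowerBoundsIW`, `P ⊆ BPP`, Adleman `BPP ⊆ P/poly`), so one-step landed
implications are visible to `exact?`.

Pieces: X₁ `QSignNotInP` (Target with `∉ BPP` ↦ `∉ Classes.P`), X₂ `EHard` (IW hypothesis, = item YbEHard stmt-17622).
Birth stubs: `ExactToffoliHNotInP` (EQP_{T+H} ⊄ P), route support `CoExactIsQuantizedSign`; `EHardIO`, `EHardIOToAE` (YbEHard's).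
S := `_root_.QuantumAdvantage`, X := `Theses.DyadicGap.Target`.
-/

set_option linter.dupNamespace false

namespace Summit.QuantumAdvantage.QuantumAdvantage.Cruxes.Target.DyadicGapProbes

open Summit.QuantumAdvantage.QuantumAdvantage.Theses.DyadicGap
open scoped Classical

def QSignNotInP : Prop :=
  ∃ (F : Literature.Computability.Cryptography.QCircuitFamily Literature.Computability.Cryptography.toffoliH) (c : ℕ), F.IsOracleFree ∧ @Literature.Computability.Cryptography.QCircuitFamily.IsUniform Literature.Computability.Cryptography.toffoliH (inferInstanceAs (Encodable Literature.Computability.Cryptography.ToffoliHOp)) F ∧ (∀ x : List Bool, ∃ (q : ℕ) (k : ℤ), 2 ^ q ≤ (x.length + 2) ^ c ∧ ((F.circ x.length).mat (Literature.Computability.Cryptography.padInput x.get (F.ancillas x.length)) (Literature.Computability.Cryptography.padInput x.get (F.ancillas x.length))) = (k : ℂ) / (2 : ℂ) ^ q) ∧ ({x : List Bool | 0 < ((F.circ x.length).mat (Literature.Computability.Cryptography.padInput x.get (F.ancillas x.length)) (Literature.Computability.Cryptography.padInput x.get (F.ancillas x.length))).re} : Language Bool) ∉ Literature.Computability.Co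mplexity.Classes.P

def EHard : Prop :=
  ∃ L ∈ Literature.Computability.Complexity.E, ∃ ε : ℝ, 0 < ε ∧ ∀ᶠ n : ℕ in Filter.atTop, (2 : ℝ) ^ (ε * n) ≤ (L.circuitSize n : ℝ)

def ExactToffoliHNotInP : Prop :=
  ∃ L ∈ @Literature.Computability.Cryptography.BQPWith Literature.Computability.Cryptography.toffoliH (inferInstanceAs (Encodable Literature.Computability.Cryptography.ToffoliHOp)) 0, L ∉ Literature.Computability.Complexity.Classes.P

def EHardIO : Prop :=
  ∃ L ∈ Literature.Computability.Complexity.E, ∃ ε : ℝ, 0 < ε ∧ ∃ᶠ n : ℕ in Filter.atTop, (2 : ℝ) ^ (ε * n) ≤ (L.circuitSize n : ℝ)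

def EHardIOToAE : Prop := EHardIO → EHard

-- C0 calibration (MUST SUCCEED, no sorry): the route's deciding theorem is visible to `exact?`
set_option maxHeartbeats 400000 in
example : QuantizedSignInBQP → Target → _root_.QuantumAdvantage := by
  first | exact? | sorry
-- (c) piece QSignNotInP → S
set_option maxHeartbeats 400000 in
example : QSignNotInP → _root_.QuantumAdvantage := by
  first | exact? | simpa [QSignNotInP] | (unfold QSignNotInP; simpa) | (aesop (config := { terminal := true })) | sorry

-- (c) piece QSignNotInP → X
set_option maxHeartbeats 400000 in
example : QSignNotInP → Target := by
  first | exact? | simpa [QSignNotInP] | (unfold QSignNotInP; simpa) | (aesop (config := { terminal := true })) | sorry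

-- (c) piece EHard → S
set_option maxHeartbeats 400000 in
example : EHard → _root_.QuantumAdvantage := by
  first | exact? | simpa [EHard] | (unfold EHard; simpa) | (aesop (config := { terminal := true })) | sorry

-- (c) piece EHard → X
set_option maxHeartbeats 400000 in
example : EHard → Target := by
  first | exact? | simpa [EHard] | (unfold EHard; simpa) | (aesop (config := { terminal := true })) | sorry

-- converse S → QSignNotInP
set_option maxHeartbeats 400000 in
example : _root_.QuantumAdvantage → QSignNotInP := by
  first | exact? | simpa [QSignNotInP] | (unfold QSignNotInP; simpa) | (aesop (config := { terminal := true })) | sorry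

-- converse X → QSignNotInP (TRUE by P ⊆ BPP: DyadicGapTargetSplit.qSignNotInP_of_target; recorded whether the cheap probe sees it)
set_option maxHeartbeats 400000 in
example : Target → QSignNotInP := by
  first | exact? | simpa [QSignNotInP] | (unfold QSignNotInP; simpa) | (aesop (config := { terminal := true })) | sorry

-- negation side ¬S → QSignNotInP
set_option maxHeartbeats 400000 in
example : ¬ _root_.QuantumAdvantage → QSignNotInP := by
  first | exact? | simpa [QSignNotInP] | (unfold QSignNotInP; simpa) | (aesop (config := { terminal := true })) | sorry

-- converse S → EHard
set_option maxHeartbeats 400000 in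
example : _root_.QuantumAdvantage → EHard := by
  first | exact? | simpa [EHard] | (unfold EHard; simpa) | (aesop (config := { terminal := true })) | sorry

-- converse X → EHard
set_option maxHeartbeats 400000 in
example : Target → EHard := by
  first | exact? | simpa [EHard] | (unfold EHard; simpa) | (aesop (config := { terminal := true })) | sorry

-- negation side ¬S → EHard
set_option maxHeartbeats 400000 in
example : ¬ _root_.QuantumAdvantage → EHard := by
  first | exact? | simpa [EHard] | (unfold EHard; simpa) | (aesop (config := { terminal := true })) | sorry

-- piece → piece
set_option maxHeartbeats 400000 in
example : QSignNotInP → EHard := by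
  first | exact? | simpa [QSignNotInP, EHard] | (unfold QSignNotInP EHard; simpa) | (aesop (config := { terminal := true })) | sorry

-- piece → piece
set_option maxHeartbeats 400000 in
example : EHard → QSignNotInP := by
  first | exact? | simpa [QSignNotInP, EHard] | (unfold QSignNotInP EHard; simpa) | (aesop (config := { terminal := true })) | sorry

-- BC3 stub ExactToffoliHNotInP → its piece
set_option maxHeartbeats 400000 in
example : ExactToffoliHNotInP → QSignNotInP := by
  first | exact? | simpa [ExactToffoliHNotInP, QSignNotInP] | (unfold ExactToffoliHNotInP QSignNotInP; simpa) | (aesop (config := { terminal := true })) | sorry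

-- BC3 stub ExactToffoliHNotInP → S
set_option maxHeartbeats 400000 in
example : ExactToffoliHNotInP → _root_.QuantumAdvantage := by
  first | exact? | simpa [ExactToffoliHNotInP] | (unfold ExactToffoliHNotInP; simpa) | (aesop (config := { terminal := true })) | sorry

-- BC3 stub ExactToffoliHNotInP → X
set_option maxHeartbeats 400000 in
example : ExactToffoliHNotInP → Target := by
  first | exact? | simpa [ExactToffoliHNotInP] | (unfold ExactToffoliHNotInP; simpa) | (aesop (config := { terminal := true })) | sorry

-- BC3 stub CoExactIsQuantizedSign → its piece
set_option maxHeartbeats 400000 in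
example : CoExactIsQuantizedSign → QSignNotInP := by
  first | exact? | simpa [CoExactIsQuantizedSign, QSignNotInP] | (unfold CoExactIsQuantizedSign QSignNotInP; simpa) | (aesop (config := { terminal := true })) | sorry

-- BC3 stub CoExactIsQuantizedSign → S
set_option maxHeartbeats 400000 in
example : CoExactIsQuantizedSign → _root_.QuantumAdvantage := by
  first | exact? | simpa [CoExactIsQuantizedSign] | (unfold CoExactIsQuantizedSign; simpa) | (aesop (config := { terminal := true })) | sorry

-- BC3 stub CoExactIsQuantizedSign → X
set_option maxHeartbeats 400000 in
example : CoExactIsQuantizedSign → Target := by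
  first | exact? | simpa [CoExactIsQuantizedSign] | (unfold CoExactIsQuantizedSign; simpa) | (aesop (config := { terminal := true })) | sorry

-- BC3 stub EHardIO → its piece
set_option maxHeartbeats 400000 in
example : EHardIO → EHard := by
  first | exact? | simpa [EHardIO, EHard] | (unfold EHardIO EHard; simpa) | (aesop (config := { terminal := true })) | sorry

-- BC3 stub EHardIO → S
set_option maxHeartbeats 400000 in
example : EHardIO → _root_.QuantumAdvantage := by
  first | exact? | simpa [EHardIO] | (unfold EHardIO; simpa) | (aesop (config := { terminal := true })) | sorry

-- BC3 stub EHardIO → X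
set_option maxHeartbeats 400000 in
example : EHardIO → Target := by
  first | exact? | simpa [EHardIO] | (unfold EHardIO; simpa) | (aesop (config := { terminal := true })) | sorry

-- BC3 stub EHardIOToAE → its piece
set_option maxHeartbeats 400000 in
example : EHardIOToAE → EHard := by
  first | exact? | simpa [EHardIOToAE, EHard] | (unfold EHardIOToAE EHard; simpa) | (aesop (config := { terminal := true })) | sorry

-- BC3 stub EHardIOToAE → S
set_option maxHeartbeats 400000 in
example : EHardIOToAE → _root_.QuantumAdvantage := by
  first | exact? | simpa [EHardIOToAE] | (unfold EHardIOToAE; simpa) | (aesop (config := { terminal := true })) | sorry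

-- BC3 stub EHardIOToAE → X
set_option maxHeartbeats 400000 in
example : EHardIOToAE → Target := by
  first | exact? | simpa [EHardIOToAE] | (unfold EHardIOToAE; simpa) | (aesop (config := { terminal := true })) | sorry
-- BC4 dedup D1: the piece is not a known theorem / provable existing item
set_option maxHeartbeats 400000 in
example : QSignNotInP := by
  first | exact? | sorry
-- BC4 dedup D2
set_option maxHeartbeats 400000 in
example : EHard := by
  first | exact? | sorry

end Summit.QuantumAdvantage.QuantumAdvantage.Cruxes.Target.DyadicGapProbes
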